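import Mathlib
import Summits.MatrixMultiplication.MatrixMultiplication.Theorems.GradedDesignFamily.Negative.SubfieldCellNormalFormAux
import Summits.MatrixMultiplication.MatrixMultiplication.Theorems.GradedDesignFamily.Negative.SubfieldCellSubfieldTwo

/-!
# (N) Normal form of an injective hom `SL₂(k) →* GL₂(K)`, `|K| = |k|²`
# (crux `LevelGradedCohnUmans.GradedDesignFamily`, stmt-MatrixMultiplication-7610; negative side,
# line `quadratic-extension-level-one-cell`, unit b2b-lgcu-subfield gen 19)

HONEST FRAMING.  Input (N) of route (D′) (removing the hypothesis (Dickson) from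
`not_subfieldCell_of_BGT_Dickson`): every injective hom `φ : SL₂(k) →* GL₂(K)`, `|K| = |k|²`, is
conjugate to a Galois twist of the standard embedding: `φ(a) = g₀ · ι(a) · g₀⁻¹` for a ring hom
`ι : k →+* K` and `g₀ ∈ GL₂(K)`.  Proof (elementary): the images of the upper unipotents are commuting
square-zero perturbations of `1` with a common fixed vector `v₁`; `v₂ = φ(w)v₁` is fixed by the lower
ones; `v₁, v₂` are independent (else `φ(u_1), φ(l_1)` commute); in the basis `(v₁, v₂)`,
`φ(u_x) = [[1, ℓ x],[0,1]]`, `φ(l_x) = [[1,0],[ℓ' x,1]]` with `ℓ` additive; the torus relation and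
"every element is a sum of two squares" make `ι = ℓ/ℓ(1)` a ring hom, the relation `w = u_1 l_{-1} u_1`
gives `ℓ' = ι/ℓ(1)`, and conjugating by `diag(ℓ 1, 1)` finishes.  NEGATIVE-side toolkit for the design
stub S3; NOT summit progress.

Sorry-free. [folklore]
-/

set_option linter.dupNamespace false

open Matrix

namespace Summit.MatrixMultiplication.MatrixMultiplication.Theorems.GradedDesignFamily.Negative

section NormalForm

variable {k K : Type} [Field k] [Fintype k] [DecidableEq k] [Field K] [Fintype K] [DecidableEq K]

/-- **(N) Normal form.**  An injective hom `φ : SL₂(k) →* GL₂(K)`, `|K| = |k|²`, is conjugate to a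
Galois twist of the standard embedding: `φ(a) = g₀ · ι(a) · g₀⁻¹`.  NOT summit progress. [folklore] -/
theorem subfieldCell_normalForm
    (φ : Matrix.SpecialLinearGroup (Fin 2) k →* Matrix.GeneralLinearGroup (Fin 2) K)
    (hφ : Function.Injective φ) (hK : Fintype.card K = Fintype.card k ^ 2) :
    ∃ (ι : k →+* K) (g₀ : Matrix.GeneralLinearGroup (Fin 2) K),
      ∀ a, φ a = g₀ * Matrix.SpecialLinearGroup.toGL (Matrix.SpecialLinearGroup.map ι a) * g₀⁻¹ := by
  classical
  -- ### the matrix map `Φ a = ↑(φ a)`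
  have hΦmul : ∀ a b, ((φ (a * b) : Matrix.GeneralLinearGroup (Fin 2) K) : Matrix (Fin 2) (Fin 2) K)
      = ((φ a : Matrix.GeneralLinearGroup (Fin 2) K) : Matrix (Fin 2) (Fin 2) K)
        * ((φ b : Matrix.GeneralLinearGroup (Fin 2) K) : Matrix (Fin 2) (Fin 2) K) := by
    intro a b; rw [map_mul, Units.val_mul]
  have hΦdet : ∀ a, Matrix.det ((φ a : Matrix.GeneralLinearGroup (Fin 2) K) :
      Matrix (Fin 2) (Fin 2) K) = 1 := subfieldCell_det_eq_one φ hK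
  have hΦinj : ∀ a, ((φ a : Matrix.GeneralLinearGroup (Fin 2) K) : Matrix (Fin 2) (Fin 2) K) = 1 →
      a = 1 := by
    intro a h
    apply hφ
    rw [map_one]
    exact Units.val_eq_one.1 h
  -- ### unipotents
  have hsq : ∀ x : k,
      (((φ ⟨_, sl2md_det_upper x⟩ : Matrix.GeneralLinearGroup (Fin 2) K) :
        Matrix (Fin 2) (Fin 2) K) - 1) *
      (((φ ⟨_, sl2md_det_upper x⟩ : Matrix.GeneralLinearGroup (Fin 2) K) :
        Matrix (Fin 2) (Fin 2) K) - 1) = 0 :=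
    fun x => subfieldCell_sub_one_sq_of_pow_char φ hK _ (subfieldCell_upper_pow_char x)
  have hsqL : ∀ x : k,
      (((φ ⟨_, sl2md_det_lower x⟩ : Matrix.GeneralLinearGroup (Fin 2) K) :
        Matrix (Fin 2) (Fin 2) K) - 1) *
      (((φ ⟨_, sl2md_det_lower x⟩ : Matrix.GeneralLinearGroup (Fin 2) K) :
        Matrix (Fin 2) (Fin 2) K) - 1) = 0 :=
    fun x => subfieldCell_lower_sub_one_sq φ hK x
  have hN1ne : (((φ ⟨_, sl2md_det_upper (1 : k)⟩ : Matrix.GeneralLinearGroup (Fin 2) K) :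
      Matrix (Fin 2) (Fin 2) K) - 1) ≠ 0 := by
    intro h
    have h1 := hΦinj ⟨_, sl2md_det_upper (1 : k)⟩ (sub_eq_zero.1 h)
    have := congr_arg (fun g : Matrix.SpecialLinearGroup (Fin 2) k => (g : Matrix (Fin 2) (Fin 2) k) 0 1) h1
    simp at this
  -- ### the common fixed vector `v₁` of the upper unipotents
  obtain ⟨v₁, hv₁, hNv₁⟩ : ∃ v₁ : Fin 2 → K, v₁ ≠ 0 ∧
      (((φ ⟨_, sl2md_det_upper (1 : k)⟩ : Matrix.GeneralLinearGroup (Fin 2) K) :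
        Matrix (Fin 2) (Fin 2) K) - 1) *ᵥ v₁ = 0 := by
    have hdet0 : Matrix.det (((φ ⟨_, sl2md_det_upper (1 : k)⟩ :
        Matrix.GeneralLinearGroup (Fin 2) K) : Matrix (Fin 2) (Fin 2) K) - 1) = 0 := by
      have h := congr_arg Matrix.det (hsq 1)
      rwa [Matrix.det_mul, Matrix.det_zero, mul_self_eq_zero] at h
    obtain ⟨v, hv, h⟩ := Matrix.exists_mulVec_eq_zero_iff.2 hdet0
    exact ⟨v, hv, h⟩
  have hUfix : ∀ x : k, ((φ ⟨_, sl2md_det_upper x⟩ : Matrix.GeneralLinearGroup (Fin 2) K) :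
      Matrix (Fin 2) (Fin 2) K) *ᵥ v₁ = v₁ := by
    intro x
    have hc :
        (((φ ⟨_, sl2md_det_upper (1 : k)⟩ : Matrix.GeneralLinearGroup (Fin 2) K) :
          Matrix (Fin 2) (Fin 2) K) - 1) *
        (((φ ⟨_, sl2md_det_upper x⟩ : Matrix.GeneralLinearGroup (Fin 2) K) :
          Matrix (Fin 2) (Fin 2) K) - 1) =
        (((φ ⟨_, sl2md_det_upper x⟩ : Matrix.GeneralLinearGroup (Fin 2) K) :
          Matrix (Fin 2) (Fin 2) K) - 1) *
        (((φ ⟨_, sl2md_det_upper (1 : k)⟩ : Matrix.GeneralLinearGroup (Fin 2) K) :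
          Matrix (Fin 2) (Fin 2) K) - 1) := by
      have h : ((φ ⟨_, sl2md_det_upper (1 : k)⟩ : Matrix.GeneralLinearGroup (Fin 2) K) :
            Matrix (Fin 2) (Fin 2) K) *
          ((φ ⟨_, sl2md_det_upper x⟩ : Matrix.GeneralLinearGroup (Fin 2) K) :
            Matrix (Fin 2) (Fin 2) K) =
          ((φ ⟨_, sl2md_det_upper x⟩ : Matrix.GeneralLinearGroup (Fin 2) K) :
            Matrix (Fin 2) (Fin 2) K) *
          ((φ ⟨_, sl2md_det_upper (1 : k)⟩ : Matrix.GeneralLinearGroup (Fin 2) K) :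
            Matrix (Fin 2) (Fin 2) K) := by
        rw [← hΦmul, ← hΦmul, sl2md_upper_mul, sl2md_upper_mul, add_comm]
      simp only [sub_mul, mul_sub, mul_one, one_mul, h]
      abel
    have h0 := fin_two_commuting_sqZero_mulVec _ _ hN1ne (hsq x) hc v₁ hv₁ hNv₁
    rwa [Matrix.sub_mulVec, Matrix.one_mulVec, sub_eq_zero] at h0
  -- ### `v₂ = φ(w) v₁` is fixed by the lower unipotents
  obtain ⟨v₂, hv₂def⟩ : ∃ v₂ : Fin 2 → K, v₂ =
      ((φ ⟨_, sl2md_det_weyl⟩ : Matrix.GeneralLinearGroup (Fin 2) K) : Matrix (Fin 2) (Fin 2) K)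
        *ᵥ v₁ := ⟨_, rfl⟩
  have hLfix : ∀ x : k, ((φ ⟨_, sl2md_det_lower x⟩ : Matrix.GeneralLinearGroup (Fin 2) K) :
      Matrix (Fin 2) (Fin 2) K) *ᵥ v₂ = v₂ := by
    intro x
    rw [hv₂def, Matrix.mulVec_mulVec, ← hΦmul]
    have e : (⟨_, sl2md_det_lower x⟩ * ⟨_, sl2md_det_weyl⟩ : Matrix.SpecialLinearGroup (Fin 2) k)
        = ⟨_, sl2md_det_weyl⟩ * ⟨_, sl2md_det_upper (-x)⟩ := (sl2md_weyl_mul_upper x).symm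
    rw [e, hΦmul, ← Matrix.mulVec_mulVec, hUfix]
  have hv₂ : v₂ ≠ 0 := by
    intro h
    apply hv₁
    have e : ((φ (⟨_, sl2md_det_weyl⟩⁻¹ : Matrix.SpecialLinearGroup (Fin 2) k) :
        Matrix.GeneralLinearGroup (Fin 2) K) : Matrix (Fin 2) (Fin 2) K) *ᵥ v₂ = v₁ := by
      rw [hv₂def, Matrix.mulVec_mulVec, ← hΦmul, inv_mul_cancel, map_one, Units.val_one,
        Matrix.one_mulVec]
    rw [← e, h, Matrix.mulVec_zero]
  -- ### `v₁, v₂` are independent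
  have hD : v₁ 0 * v₂ 1 - v₁ 1 * v₂ 0 ≠ 0 := by
    intro hD0
    obtain ⟨c, hc⟩ : ∃ c : K, v₂ = c • v₁ := by
      by_cases h0 : v₁ 0 = 0
      · have h1 : v₁ 1 ≠ 0 := by
          intro h1; apply hv₁; ext i; fin_cases i <;> simp [h0, h1]
        have h20 : v₂ 0 = 0 := by
          have : v₁ 1 * v₂ 0 = 0 := by
            rw [h0, zero_mul, zero_sub, neg_eq_zero] at hD0; exact hD0
          exact (mul_eq_zero.1 this).resolve_left h1
        refine ⟨v₂ 1 / v₁ 1, ?_⟩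
        ext i; fin_cases i
        · simp [h20, h0]
        · simp [div_mul_cancel₀ _ h1]
      · refine ⟨v₂ 0 / v₁ 0, ?_⟩
        ext i; fin_cases i
        · simp [div_mul_cancel₀ _ h0]
        · simp only [Fin.mk_one, Pi.smul_apply, smul_eq_mul]
          field_simp
          linear_combination hD0
    have hc0 : c ≠ 0 := by
      rintro rfl; apply hv₂; rw [hc, zero_smul]
    have hMv₁ : (((φ ⟨_, sl2md_det_lower (1 : k)⟩ : Matrix.GeneralLinearGroup (Fin 2) K) :
        Matrix (Fin 2) (Fin 2) K) - 1) *ᵥ v₁ = 0 := by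
      have h := hLfix 1
      rw [hc, Matrix.mulVec_smul] at h
      have h' := smul_right_injective (Fin 2 → K) hc0 h
      rw [Matrix.sub_mulVec, Matrix.one_mulVec, sub_eq_zero]
      exact h'
    have hNM := fin_two_mul_eq_zero_of_common_ker _ _ (hsqL 1) v₁ hv₁ hNv₁ hMv₁
    have hMN := fin_two_mul_eq_zero_of_common_ker _ _ (hsq 1) v₁ hv₁ hMv₁ hNv₁
    have hcomm :
        ((φ ⟨_, sl2md_det_upper (1 : k)⟩ : Matrix.GeneralLinearGroup (Fin 2) K) :
          Matrix (Fin 2) (Fin 2) K) *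
        ((φ ⟨_, sl2md_det_lower (1 : k)⟩ : Matrix.GeneralLinearGroup (Fin 2) K) :
          Matrix (Fin 2) (Fin 2) K) =
        ((φ ⟨_, sl2md_det_lower (1 : k)⟩ : Matrix.GeneralLinearGroup (Fin 2) K) :
          Matrix (Fin 2) (Fin 2) K) *
        ((φ ⟨_, sl2md_det_upper (1 : k)⟩ : Matrix.GeneralLinearGroup (Fin 2) K) :
          Matrix (Fin 2) (Fin 2) K) := by
      simp only [sub_mul, mul_sub, mul_one, one_mul] at hNM hMN
      rw [sub_sub, sub_eq_zero] at hNM hMN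
      rw [hNM, hMN]
      abel
    have hSL : (⟨_, sl2md_det_upper (1 : k)⟩ * ⟨_, sl2md_det_lower (1 : k)⟩ :
        Matrix.SpecialLinearGroup (Fin 2) k) = ⟨_, sl2md_det_lower (1 : k)⟩ * ⟨_, sl2md_det_upper (1 : k)⟩ := by
      apply hφ
      apply Units.ext
      rw [map_mul, map_mul, Units.val_mul, Units.val_mul]
      exact hcomm
    have := congr_arg (fun g : Matrix.SpecialLinearGroup (Fin 2) k => (g : Matrix (Fin 2) (Fin 2) k) 0 0) hSL
    simp [Matrix.mul_apply, Fin.sum_univ_two] at this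
  -- ### change of basis `g₁ = (v₁ | v₂)`
  obtain ⟨g₁, hg₁def⟩ : ∃ g₁ : Matrix (Fin 2) (Fin 2) K, g₁ = !![v₁ 0, v₂ 0; v₁ 1, v₂ 1] :=
    ⟨_, rfl⟩
  have hg₁det : g₁.det = v₁ 0 * v₂ 1 - v₁ 1 * v₂ 0 := by
    rw [hg₁def, Matrix.det_fin_two_of]; ring
  have hg₁unit : IsUnit g₁.det := by rw [hg₁det]; exact isUnit_iff_ne_zero.2 hD
  have hg₁e0 : g₁ *ᵥ ![1, 0] = v₁ := by
    rw [fin_two_mulVec_e0]; ext i; fin_cases i <;> simp [hg₁def]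
  have hg₁e1 : g₁ *ᵥ ![0, 1] = v₂ := by
    rw [fin_two_mulVec_e1]; ext i; fin_cases i <;> simp [hg₁def]
  -- `Ψ a = g₁⁻¹ φ(a) g₁`
  have hΨmul : ∀ a b,
      g₁⁻¹ * ((φ (a * b) : Matrix.GeneralLinearGroup (Fin 2) K) : Matrix (Fin 2) (Fin 2) K) * g₁ =
      (g₁⁻¹ * ((φ a : Matrix.GeneralLinearGroup (Fin 2) K) : Matrix (Fin 2) (Fin 2) K) * g₁) *
      (g₁⁻¹ * ((φ b : Matrix.GeneralLinearGroup (Fin 2) K) : Matrix (Fin 2) (Fin 2) K) * g₁) := by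
    intro a b
    rw [hΦmul]
    simp only [Matrix.mul_assoc, Matrix.mul_nonsing_inv_cancel_left _ _ hg₁unit]
  have hΨdet : ∀ a, Matrix.det (g₁⁻¹ * ((φ a : Matrix.GeneralLinearGroup (Fin 2) K) :
      Matrix (Fin 2) (Fin 2) K) * g₁) = 1 := by
    intro a
    rw [Matrix.det_mul, Matrix.det_mul, hΦdet, mul_one, ← Matrix.det_mul,
      Matrix.nonsing_inv_mul _ hg₁unit, Matrix.det_one]
  have hΨinj : ∀ a, g₁⁻¹ * ((φ a : Matrix.GeneralLinearGroup (Fin 2) K) :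
      Matrix (Fin 2) (Fin 2) K) * g₁ = 1 → a = 1 := by
    intro a h
    apply hΦinj
    have e : ((φ a : Matrix.GeneralLinearGroup (Fin 2) K) : Matrix (Fin 2) (Fin 2) K) =
        g₁ * (g₁⁻¹ * ((φ a : Matrix.GeneralLinearGroup (Fin 2) K) : Matrix (Fin 2) (Fin 2) K)
          * g₁) * g₁⁻¹ := by
      rw [Matrix.mul_assoc, Matrix.mul_assoc, Matrix.mul_nonsing_inv _ hg₁unit, Matrix.mul_one,
        Matrix.mul_nonsing_inv_cancel_left _ _ hg₁unit]
    rw [e, h, Matrix.mul_one, Matrix.mul_nonsing_inv _ hg₁unit]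
  have hΨconj : ∀ a (X : Matrix (Fin 2) (Fin 2) K),
      g₁⁻¹ * ((φ a : Matrix.GeneralLinearGroup (Fin 2) K) : Matrix (Fin 2) (Fin 2) K) * g₁ = X →
      ((φ a : Matrix.GeneralLinearGroup (Fin 2) K) : Matrix (Fin 2) (Fin 2) K) * g₁ = g₁ * X := by
    intro a X h
    rw [← h, Matrix.mul_assoc, Matrix.mul_nonsing_inv_cancel_left _ _ hg₁unit]
  -- shapes of `Ψ(u_x)`, `Ψ(l_x)`
  have hΨU0 : ∀ x : k, (g₁⁻¹ * ((φ ⟨_, sl2md_det_upper x⟩ : Matrix.GeneralLinearGroup (Fin 2) K) :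
      Matrix (Fin 2) (Fin 2) K) * g₁) *ᵥ ![1, 0] = ![1, 0] := by
    intro x
    rw [← Matrix.mulVec_mulVec, ← Matrix.mulVec_mulVec, hg₁e0, hUfix, ← hg₁e0, Matrix.mulVec_mulVec,
      Matrix.nonsing_inv_mul _ hg₁unit, Matrix.one_mulVec]
  have hΨL1 : ∀ x : k, (g₁⁻¹ * ((φ ⟨_, sl2md_det_lower x⟩ : Matrix.GeneralLinearGroup (Fin 2) K) :
      Matrix (Fin 2) (Fin 2) K) * g₁) *ᵥ ![0, 1] = ![0, 1] := by
    intro x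
    rw [← Matrix.mulVec_mulVec, ← Matrix.mulVec_mulVec, hg₁e1, hLfix, ← hg₁e1, Matrix.mulVec_mulVec,
      Matrix.nonsing_inv_mul _ hg₁unit, Matrix.one_mulVec]
  obtain ⟨ℓ, hℓ⟩ : ∃ ℓ : k → K, ∀ x, ℓ x = (g₁⁻¹ * ((φ ⟨_, sl2md_det_upper x⟩ :
      Matrix.GeneralLinearGroup (Fin 2) K) : Matrix (Fin 2) (Fin 2) K) * g₁) 0 1 := ⟨_, fun _ => rfl⟩
  obtain ⟨ℓ', hℓ'⟩ : ∃ ℓ' : k → K, ∀ x, ℓ' x = (g₁⁻¹ * ((φ ⟨_, sl2md_det_lower x⟩ :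
      Matrix.GeneralLinearGroup (Fin 2) K) : Matrix (Fin 2) (Fin 2) K) * g₁) 1 0 := ⟨_, fun _ => rfl⟩
  have hU : ∀ x : k, g₁⁻¹ * ((φ ⟨_, sl2md_det_upper x⟩ : Matrix.GeneralLinearGroup (Fin 2) K) :
      Matrix (Fin 2) (Fin 2) K) * g₁ = !![1, ℓ x; 0, 1] := by
    intro x; rw [hℓ]; exact fin_two_eq_upper_of_fix _ (hΨU0 x) (hΨdet _)
  have hL : ∀ x : k, g₁⁻¹ * ((φ ⟨_, sl2md_det_lower x⟩ : Matrix.GeneralLinearGroup (Fin 2) K) :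
      Matrix (Fin 2) (Fin 2) K) * g₁ = !![1, 0; ℓ' x, 1] := by
    intro x; rw [hℓ']; exact fin_two_eq_lower_of_fix _ (hΨL1 x) (hΨdet _)
  -- ### `ℓ` is additive and injective
  have hℓadd : ∀ x y, ℓ (x + y) = ℓ x + ℓ y := by
    intro x y
    have h := hΨmul ⟨_, sl2md_det_upper x⟩ ⟨_, sl2md_det_upper y⟩
    rw [sl2md_upper_mul, hU (x + y), hU x, hU y] at h
    have := congr_arg (fun X : Matrix (Fin 2) (Fin 2) K => X 0 1) h
    simpa [Matrix.mul_apply, Fin.sum_univ_two, add_comm] using this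
  have hℓ0 : ℓ 0 = 0 := by
    have h := hℓadd 0 0
    rw [add_zero] at h
    linear_combination (-1 : K) * h
  have hℓneg : ∀ x, ℓ (-x) = -ℓ x := by
    intro x
    have h := hℓadd x (-x)
    rw [add_neg_cancel, hℓ0] at h
    linear_combination (-1 : K) * h
  have hℓne : ∀ x, x ≠ 0 → ℓ x ≠ 0 := by
    intro x hx h0
    apply hx
    have h1 := hΨinj ⟨_, sl2md_det_upper x⟩ (by rw [hU x, h0, Matrix.one_fin_two])
    have := congr_arg (fun g : Matrix.SpecialLinearGroup (Fin 2) k => (g : Matrix (Fin 2) (Fin 2) k) 0 1) h1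
    simpa using this
  have hlam : ℓ 1 ≠ 0 := hℓne 1 one_ne_zero
  -- ### torus relation `ℓ(s² x) ℓ(1) = ℓ(s²) ℓ(x)`
  have htorus : ∀ (t : kˣ) (x : k), ℓ ((t : k) * t * x) * ℓ 1 = ℓ ((t : k) * t) * ℓ x := by
    intro t x
    obtain ⟨D, hDdef⟩ : ∃ D : Matrix (Fin 2) (Fin 2) K,
        g₁⁻¹ * ((φ ⟨_, sl2md_det_diag t⟩ : Matrix.GeneralLinearGroup (Fin 2) K) :
          Matrix (Fin 2) (Fin 2) K) * g₁ = D := ⟨_, rfl⟩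
    have rel : ∀ y : k, D * !![1, ℓ y; 0, 1] = !![1, ℓ ((t : k) * t * y); 0, 1] * D := by
      intro y
      rw [← hDdef, ← hU y, ← hU ((t : k) * t * y), ← hΨmul, ← hΨmul, sl2md_diag_mul_upper]
    have hdetD : D.det = 1 := by rw [← hDdef]; exact hΨdet _
    rw [Matrix.det_fin_two] at hdetD
    have e00 := congr_arg (fun X : Matrix (Fin 2) (Fin 2) K => X 0 0) (rel 1)
    have e01 := congr_arg (fun X : Matrix (Fin 2) (Fin 2) K => X 0 1) (rel 1)
    have f01 := congr_arg (fun X : Matrix (Fin 2) (Fin 2) K => X 0 1) (rel x)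
    simp only [Matrix.mul_apply, Fin.sum_univ_two, Matrix.of_apply, Matrix.cons_val',
      Matrix.cons_val_zero, Matrix.cons_val_one, Matrix.empty_val', Matrix.cons_val_fin_one,
      mul_one, mul_zero, add_zero, one_mul] at e00 e01 f01
    have htt : ℓ ((t : k) * t) ≠ 0 := hℓne _ (mul_ne_zero t.ne_zero t.ne_zero)
    -- `e00 : D₀₀ = D₀₀ + ℓ(t²) D₁₀`, so `D₁₀ = 0`
    have hc : D 1 0 = 0 := by
      have : ℓ ((t : k) * t) * D 1 0 = 0 := by linear_combination (-1 : K) * e00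
      exact (mul_eq_zero.1 this).resolve_left htt
    rw [hc] at hdetD
    have hd : D 1 1 ≠ 0 := by
      intro h; rw [h] at hdetD; simp at hdetD
    apply mul_left_cancel₀ hd
    linear_combination ℓ x * e01 - ℓ 1 * f01
  have hrel : ∀ s x : k, ℓ (s * s * x) * ℓ 1 = ℓ (s * s) * ℓ x := by
    intro s x
    by_cases hs : s = 0
    · simp [hs, hℓ0]
    · exact htorus (Units.mk0 s hs) x
  have hℓmul : ∀ x y, ℓ (x * y) * ℓ 1 = ℓ x * ℓ y := by
    intro x y
    obtain ⟨a, b, hab⟩ := finiteField_exists_sq_add_sq x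
    rw [← hab, sq, sq, add_mul, hℓadd, hℓadd, add_mul, add_mul, hrel, hrel]
  -- ### the ring hom `ι = ℓ / ℓ(1)`
  let ι : k →+* K :=
    { toFun := fun x => ℓ x * (ℓ 1)⁻¹
      map_one' := mul_inv_cancel₀ hlam
      map_mul' := by
        intro x y
        have e : ℓ (x * y) = ℓ x * ℓ y * (ℓ 1)⁻¹ := by
          rw [← hℓmul x y, mul_inv_cancel_right₀ hlam]
        simp only [e]
        ring
      map_zero' := by simp [hℓ0]
      map_add' := by intro x y; simp only [hℓadd, add_mul] }
  have hι : ∀ x, ι x = ℓ x * (ℓ 1)⁻¹ := fun _ => rfl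
  -- ### the Weyl relation: `ℓ' x = ℓ x / ℓ(1)²`
  have hℓ' : ∀ x, ℓ' x = ℓ x * (ℓ 1)⁻¹ * (ℓ 1)⁻¹ := by
    intro x
    -- `P = Ψ(w) = U(ℓ 1) L(ℓ'(-1)) U(ℓ 1)`
    have hP : g₁⁻¹ * ((φ ⟨_, sl2md_det_weyl⟩ : Matrix.GeneralLinearGroup (Fin 2) K) :
        Matrix (Fin 2) (Fin 2) K) * g₁ = !![1, ℓ 1; 0, 1] * !![1, 0; ℓ' (-1), 1] * !![1, ℓ 1; 0, 1] := by
      rw [← sl2md_weyl_eq k, hΨmul, hΨmul, hU, hL]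
    -- `P U(ℓ(-y)) = L(ℓ' y) P`
    have rel : ∀ y : k,
        (g₁⁻¹ * ((φ ⟨_, sl2md_det_weyl⟩ : Matrix.GeneralLinearGroup (Fin 2) K) :
          Matrix (Fin 2) (Fin 2) K) * g₁) * !![1, ℓ (-y); 0, 1] =
        !![1, 0; ℓ' y, 1] *
        (g₁⁻¹ * ((φ ⟨_, sl2md_det_weyl⟩ : Matrix.GeneralLinearGroup (Fin 2) K) :
          Matrix (Fin 2) (Fin 2) K) * g₁) := by
      intro y
      rw [← hU (-y), ← hL y, ← hΨmul, ← hΨmul, sl2md_weyl_mul_upper]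
    have r1 := congr_arg (fun X : Matrix (Fin 2) (Fin 2) K => X 0 1) (rel 1)
    have rx := congr_arg (fun X : Matrix (Fin 2) (Fin 2) K => X 1 1) (rel x)
    rw [hP] at r1 rx
    simp only [Matrix.mul_apply, Fin.sum_univ_two, Matrix.of_apply, Matrix.cons_val',
      Matrix.cons_val_zero, Matrix.cons_val_one, Matrix.empty_val', Matrix.cons_val_fin_one,
      mul_one, mul_zero, add_zero, one_mul, zero_mul, zero_add, hℓneg] at r1 rx
    -- `r1` gives `1 + ℓ 1 * ℓ'(-1) = 0`
    have hμ : 1 + ℓ 1 * ℓ' (-1) = 0 := by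
      have : (1 + ℓ 1 * ℓ' (-1)) * ℓ 1 = 0 := by linear_combination (-1 : K) * r1
      exact (mul_eq_zero.1 this).resolve_right hlam
    have key : ℓ' x * ℓ 1 * ℓ 1 = ℓ x := by
      linear_combination (-ℓ 1) * rx - (ℓ x + ℓ' x * ℓ 1 ^ 2) * hμ
    rw [← key, mul_inv_cancel_right₀ hlam, mul_inv_cancel_right₀ hlam]
  -- ### the conjugating matrix `G₀ = g₁ · diag(ℓ 1, 1)`
  obtain ⟨G₀, hG₀def⟩ : ∃ G₀ : Matrix (Fin 2) (Fin 2) K, G₀ = g₁ * !![ℓ 1, 0; 0, 1] := ⟨_, rfl⟩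
  have hG₀det : G₀.det ≠ 0 := by
    rw [hG₀def, Matrix.det_mul, Matrix.det_fin_two_of]
    simp only [mul_one, mul_zero, sub_zero]
    exact mul_ne_zero (hg₁det ▸ hD) hlam
  have keyU : ∀ x : k, ((φ ⟨_, sl2md_det_upper x⟩ : Matrix.GeneralLinearGroup (Fin 2) K) :
      Matrix (Fin 2) (Fin 2) K) * G₀ =
      G₀ * ((Matrix.SpecialLinearGroup.map ι ⟨_, sl2md_det_upper x⟩ :
        Matrix.SpecialLinearGroup (Fin 2) K) : Matrix (Fin 2) (Fin 2) K) := by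
    intro x
    rw [hG₀def, ← Matrix.mul_assoc, hΨconj _ _ (hU x), Matrix.mul_assoc, Matrix.mul_assoc]
    congr 1
    ext i j; fin_cases i <;> fin_cases j <;>
      simp [Matrix.mul_apply, Fin.sum_univ_two, hι, hlam, hℓ0]
    field_simp
  have keyL : ∀ x : k, ((φ ⟨_, sl2md_det_lower x⟩ : Matrix.GeneralLinearGroup (Fin 2) K) :
      Matrix (Fin 2) (Fin 2) K) * G₀ =
      G₀ * ((Matrix.SpecialLinearGroup.map ι ⟨_, sl2md_det_lower x⟩ :
        Matrix.SpecialLinearGroup (Fin 2) K) : Matrix (Fin 2) (Fin 2) K) := by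
    intro x
    rw [hG₀def, ← Matrix.mul_assoc, hΨconj _ _ (hL x), Matrix.mul_assoc, Matrix.mul_assoc]
    congr 1
    ext i j; fin_cases i <;> fin_cases j <;>
      simp [Matrix.mul_apply, Fin.sum_univ_two, hι, hlam, hℓ', hℓ0]
  have key : ∀ a, ((φ a : Matrix.GeneralLinearGroup (Fin 2) K) : Matrix (Fin 2) (Fin 2) K) * G₀ =
      G₀ * ((Matrix.SpecialLinearGroup.map ι a : Matrix.SpecialLinearGroup (Fin 2) K) :
        Matrix (Fin 2) (Fin 2) K) := by
    have kmul : ∀ a b,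
        ((φ a : Matrix.GeneralLinearGroup (Fin 2) K) : Matrix (Fin 2) (Fin 2) K) * G₀ =
          G₀ * ((Matrix.SpecialLinearGroup.map ι a : Matrix.SpecialLinearGroup (Fin 2) K) :
            Matrix (Fin 2) (Fin 2) K) →
        ((φ b : Matrix.GeneralLinearGroup (Fin 2) K) : Matrix (Fin 2) (Fin 2) K) * G₀ =
          G₀ * ((Matrix.SpecialLinearGroup.map ι b : Matrix.SpecialLinearGroup (Fin 2) K) :
            Matrix (Fin 2) (Fin 2) K) →
        ((φ (a * b) : Matrix.GeneralLinearGroup (Fin 2) K) : Matrix (Fin 2) (Fin 2) K) * G₀ =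
          G₀ * ((Matrix.SpecialLinearGroup.map ι (a * b) : Matrix.SpecialLinearGroup (Fin 2) K) :
            Matrix (Fin 2) (Fin 2) K) := by
      intro a b ha hb
      rw [hΦmul, map_mul, Matrix.SpecialLinearGroup.coe_mul, Matrix.mul_assoc, hb,
        ← Matrix.mul_assoc, ha, Matrix.mul_assoc]
    intro a
    obtain ⟨a₁, b₁, c₁, d₁, rfl⟩ := sl2md_decomp a
    exact kmul _ _ (kmul _ _ (kmul _ _ (keyU a₁) (keyL c₁)) (keyU b₁)) (keyL d₁)
  -- ### conclusion
  refine ⟨ι, Matrix.GeneralLinearGroup.mkOfDetNeZero G₀ hG₀det, fun a => ?_⟩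
  rw [eq_mul_inv_iff_mul_eq]
  apply Units.ext
  rw [Units.val_mul, Units.val_mul]
  exact key a

end NormalForm

end Summit.MatrixMultiplication.MatrixMultiplication.Theorems.GradedDesignFamily.Negative
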